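import Summits.Schanuel.Schanuel.Theorems.SoloInformedExpRank

/-!
# The uniform exponential-period rank bound in transcendence degree `≤ 1`

Soloist file (`solo-Schanuel-informed`, 2026-08-18). For a subfield `K ⊆ ℂ` let
`E(K) = {x ∈ K : eˣ ∈ K}`. Schanuel's conjecture for rank `2` says `rank_ℚ E(K) ≤ 1` whenever
`trdeg_ℚ K ≤ 1` (`schanuelRank_two_iff_expRank_le_one`). The weakest uniform shadow of this —
*some* bound `N` on `rank_ℚ E(K)` valid for every `K` of transcendence degree `≤ 1` — is recorded here
as an open named conjecture `UniformExpRankBoundTrdegLEOne`, with its derivation from the rank-`2` case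
(`N = 1`). Status of the unconditional question: by Lindemann–Weierstrass the algebraic elements of
`E(K)` span a `ℚ`-space of dimension `≤ trdeg_ℚ K`; for the logarithms of algebraic numbers in `E(K)`
no bound is known — not even the existence of two algebraically independent logarithms of algebraic
numbers is known (Waldschmidt 2000, §1.4) — so no `N` is known.

References: M. Waldschmidt, *Diophantine approximation on linear algebraic groups* (2000), Conjecture
1.14 and §1.4; D. Roy, Acta Arith. 97 (2001), Conjecture 1.
-/

noncomputable section

open Complex IntermediateField

namespace Summit.Schanuel.Schanuel.Theorems

/-- **Uniform exponential-period rank bound in transcendence degree `≤ 1`** (soloist formulation,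
`solo-Schanuel-informed` 2026-08-18; OPEN). There is `N` such that no subfield `K ⊆ ℂ` with
`trdeg_ℚ K ≤ 1` contains more than `N` `ℚ`-linearly independent numbers `x` with `eˣ ∈ K`.
Schanuel's conjecture for rank `2` gives it with `N = 1`
(`uniformExpRankBoundTrdegLEOne_of_schanuelRank_two`); unconditionally no `N` is known, not even for
the sector of logarithms of algebraic numbers [cite: Waldschmidt2000, §1.4 (algebraic independence of
logarithms: not even two algebraically independent logarithms of algebraic numbers are known)]. -/
@[conjecture] def UniformExpRankBoundTrdegLEOne : Prop :=
  ∃ N : ℕ, ∀ (K : IntermediateField ℚ ℂ), Algebra.trdeg ℚ ↥K ≤ 1 →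
    ∀ (n : ℕ) (x : Fin n → ℂ), (∀ i, x i ∈ K) → (∀ i, cexp (x i) ∈ K) →
      LinearIndependent ℚ x → n ≤ N

/-- Schanuel's conjecture for rank `2` implies the uniform bound, with `N = 1`. -/
theorem uniformExpRankBoundTrdegLEOne_of_schanuelRank_two
    (h : Literature.NumberTheory.Transcendental.SchanuelRank 2) : UniformExpRankBoundTrdegLEOne :=
  ⟨1, expRank_le_one_of_schanuelRank_two h⟩

/-- The summit implies the uniform bound (through its rank-`2` case). -/
theorem uniformExpRankBoundTrdegLEOne_of_schanuel (h : _root_.Schanuel) :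
    UniformExpRankBoundTrdegLEOne :=
  uniformExpRankBoundTrdegLEOne_of_schanuelRank_two (h 2)

end Summit.Schanuel.Schanuel.Theorems
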